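import Summits.ResolutionOfSingularities.ResolutionOfSingularities.Theorems.MarkedTransferCampaignW46MohWindowSurfaceCore
import HarnessLib

/-!
# [OURS · L1 W4.6 rung (iii-2), piece (H)] Surface Moh window — the CORE inequality for EVERY root multiplicity (heavy-root side)
# (cell res-hironaka, LADDER-RESOLUTION rung L, D-0089; unit res-L1-s46-pv-12 carried by res-D-pv-050; host MarkedTransfer,
# `--supports stmt-ResolutionOfSingularities-16155 --as helper`; statement file `…CampaignW46MohWindowSurface.lean`, res-L1-type-o1;
# object #1 «HEAVY ONE-STEP UPPER BOUND» of res-D-pv-008 AS res-L1-s46-pv-14's census `D/res-D-pv-008/H2-CENSUS.md`)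

HONEST FRAMING. Nothing here is a statement of H. Hironaka's manuscript [Hironaka2017] and nothing here asserts that any
statement of it holds. PURE COMMUTATIVE ALGEBRA over a regular local ring, sibling of `…MohWindowSurfaceCore.lean` (`core`, the
TAME case `μ < p`). AI-written; AI review is weaker than expert review. No `sorry`; axioms standard.

THE POINT. The proof of `core` (`L = 𝒪_{Z′,ξ′}` regular local of embedding dimension `3`, characteristic `p`, r.s.p. `(x, ρ, z₁)`,
`f ≡ ρ^μ · unit (mod x)`, `1 ≤ m < p`; if `(z₁^p + x^m f) = (z′^p + f″)` with `z′ ∈ 𝔪`, `f″ ∈ 𝔪^{d″}`, `d″ > p`, then `d″ ≤ m + μ`)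
uses TAMENESS `μ < p` at exactly ONE place — the estimate `m + μ + 1 ≤ 2p` absorbing the Frobenius cross term `β^p ρ^p ∈ 𝔪^{2p}`
(res-D-pv-008's diagnosis, census #1). If the competing presentation is itself a WINDOW presentation (`d″ < 2p`, as always in the
rung), that estimate is free inside the contradiction branch (`m + μ + 1 ≤ d″ < 2p`), so `d″ ≤ m + μ` holds for EVERY `μ`:
`core_le`. In the rung (`m = d − p`): `d′ + p ≤ d + μ` (`core_le_window`) — drop for `μ < p` (tame), stall allowed for `μ = p`,
growth by at most `μ − p` for `μ > p`; SHARP by res-D-pv-008's kernel growth witness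
`MohWindowSurfaceGrowth.exists_growth_step_residualOrder` (`m = 1`, `μ = p + 1`, `d″ = p + 2`). Tools as in `core`: orders in the
regular quotients `L/(x,ρ)`, `L/(x,z₁)`, `L/(z′)`, `L/(z′,x)` (Zariski–Samuel VIII §1 Thm 1 / Matsumura 14.2, 17.10 via the tree's
`RegularLocalOrder`, `RsopMonomialIdeals`). [ZariskiSamuel1960] [Matsumura1987] [HauserWagner2014]
-/

noncomputable section

set_option linter.dupNamespace false -- mandated namespace of this single-conjunct summit

namespace Summit.ResolutionOfSingularities.ResolutionOfSingularities.Theorems.CampaignW46.MohWindowSurface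

open IsLocalRing
open Literature.AlgebraicGeometry.Resolution

variable {L : Type*} [CommRing L] [IsRegularLocalRing L]

/-! ## 1. The core inequality for every root multiplicity -/

/-- **[OURS · L1 W4.6 rung (iii-2), piece (H)] CORE INEQUALITY FOR EVERY ROOT MULTIPLICITY.** Let `L` be a regular local ring of
embedding dimension `3` and characteristic `p`, with regular system of parameters `(x, ρ, z₁)`; let `f ≡ ρ^μ · G (mod x)` with `G` a
unit (`μ` ARBITRARY), and `1 ≤ m < p`. If the principal ideal `(z₁^p + x^m · f)` equals `(z′^p + f″)` for some `z′ ∈ 𝔪` and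
`f″ ∈ 𝔪^{d″}` with `p < d″ < 2p` (another WINDOW presentation at the same point), then `d″ ≤ m + μ`. Same proof as `core`, the
window bound `d″ < 2p` replacing tameness in the one estimate `m + μ + 1 ≤ 2p`. In the rung (`m = d − p`): the residual order `d′`
of a singular point of the blow-up over a window point with residual order `d` satisfies `d′ ≤ (d − p) + μ`, `μ` the multiplicity
of the root of the residue binary form under it — `< d` for `μ < p` (tame, `core`), `≤ d` for `μ = p` (stall allowed),
`≤ d + (μ − p)` for `μ > p` (growth by at most `μ − p`, attained). NOT a statement of the manuscript. [folklore] -/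
theorem core_le (p : ℕ) [Fact p.Prime] [CharP L p] (h3 : (maximalIdeal L).spanFinrank = 3)
    {x ρ z₁ : L} (hgen : Ideal.span {x, ρ, z₁} = maximalIdeal L)
    {m μ : ℕ} (hm1 : 1 ≤ m) (hmp : m < p)
    {f G : L} (hG : IsUnit G) (hf : f - ρ ^ μ * G ∈ Ideal.span {x})
    {z' f'' : L} {d'' : ℕ} (hz' : z' ∈ maximalIdeal L) (hf'' : f'' ∈ maximalIdeal L ^ d'')
    (hpd : p < d'') (hd2 : d'' < 2 * p) (heq : Ideal.span {z₁ ^ p + x ^ m * f} = Ideal.span {z' ^ p + f''}) :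
    d'' ≤ m + μ := by
  classical
  haveI := isDomain_of_isRegularLocalRing (R := L)
  have hp1 : 1 ≤ p := (Fact.out : p.Prime).one_lt.le
  set g : L := z₁ ^ p + x ^ m * f with hg
  -- (1) the two generators differ by a unit
  obtain ⟨u, hu⟩ := Ideal.span_singleton_eq_span_singleton.mp heq
  -- membership facts downstairs
  have hx𝔪 : x ∈ maximalIdeal L := hgen ▸ Ideal.subset_span (by simp)
  have hρ𝔪 : ρ ∈ maximalIdeal L := hgen ▸ Ideal.subset_span (by simp)
  have hz𝔪 : z₁ ∈ maximalIdeal L := hgen ▸ Ideal.subset_span (by simp)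
  -- (2) expand `z'` in the parameters
  have hz'mem : z' ∈ Ideal.span ({x, ρ, z₁} : Set L) := hgen ▸ hz'
  obtain ⟨α, r, hr, hz'eq⟩ := Ideal.mem_span_insert.mp hz'mem
  obtain ⟨β, lam, rfl⟩ := Ideal.mem_span_pair.mp hr
  -- so `z' = α * x + (β * ρ + lam * z₁)`
  -- (3) `lam` is a unit: read in `L/(x, ρ)`
  have hlam : IsUnit lam := by
    by_contra hlam
    have hlam𝔪 : lam ∈ maximalIdeal L := (mem_maximalIdeal _).mpr (mem_nonunits_iff.mpr hlam)
    obtain ⟨hreg, hz2⟩ := quotient_pair h3 hgen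
    haveI := hreg
    have hle : Ideal.span {x, ρ} ≤ maximalIdeal L := by
      rw [Ideal.span_le]; intro a ha; rcases ha with rfl | rfl <;> simpa
    haveI := nontrivial_quotient_of_le hle
    set π := Ideal.Quotient.mk (Ideal.span ({x, ρ} : Set L)) with hπ
    have hπx : π x = 0 := Ideal.Quotient.eq_zero_iff_mem.mpr (Ideal.subset_span (by simp))
    have hπρ : π ρ = 0 := Ideal.Quotient.eq_zero_iff_mem.mpr (Ideal.subset_span (by simp))
    have hπg : π g = π z₁ ^ p := by
      rw [hg, map_add, map_pow, map_mul, map_pow, hπx, zero_pow (by omega), zero_mul, add_zero]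
    have hπz' : π z' = π lam * π z₁ := by
      rw [hz'eq, map_add, map_mul, map_add, map_mul, map_mul, hπx, hπρ, mul_zero, mul_zero, zero_add,
        zero_add]
    -- `π z' ∈ 𝔪̄²`, hence `π (z'^p + f'') ∈ 𝔪̄^{p+1}`
    have h1 : π z' ∈ maximalIdeal _ ^ 2 := by
      rw [hπz', pow_two]
      exact Ideal.mul_mem_mul (mk_mem_maximalIdeal _ hlam𝔪) (mk_mem_maximalIdeal _ hz𝔪)
    have h2 : π (z' ^ p + f'') ∈ maximalIdeal _ ^ (p + 1) := by
      rw [map_add, map_pow]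
      refine Ideal.add_mem _ ?_ ?_
      · have := Ideal.pow_mem_pow h1 p
        rw [← pow_mul] at this
        exact Ideal.pow_le_pow_right (by omega) this
      · exact Ideal.pow_le_pow_right (by omega) (mk_mem_maximalIdeal_pow _ hf'')
    rw [← hu, map_mul, hπg, mul_comm] at h2
    exact unit_mul_pow_not_mem_pow_succ hz2 ((Units.isUnit u).map π) p h2
  -- (4) `β ∈ 𝔪`: read in `L/(x, z₁)`
  have hβ : β ∈ maximalIdeal L := by
    by_contra hβ
    have hβu : IsUnit β := not_not.mp fun h => hβ ((mem_maximalIdeal _).mpr (mem_nonunits_iff.mpr h))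
    have hgen' : Ideal.span {x, z₁, ρ} = maximalIdeal L := by rw [← triple_swap]; exact hgen
    obtain ⟨hreg, hρ2⟩ := quotient_pair h3 hgen'
    haveI := hreg
    have hle : Ideal.span {x, z₁} ≤ maximalIdeal L := by
      rw [Ideal.span_le]; intro a ha; rcases ha with rfl | rfl <;> simpa
    haveI := nontrivial_quotient_of_le hle
    set π := Ideal.Quotient.mk (Ideal.span ({x, z₁} : Set L)) with hπ
    have hπx : π x = 0 := Ideal.Quotient.eq_zero_iff_mem.mpr (Ideal.subset_span (by simp))
    have hπz : π z₁ = 0 := Ideal.Quotient.eq_zero_iff_mem.mpr (Ideal.subset_span (by simp))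
    have hπg : π g = 0 := by
      rw [hg, map_add, map_pow, map_mul, map_pow, hπx, hπz, zero_pow (by omega), zero_pow (by omega),
        zero_mul, add_zero]
    have hπz' : π z' = π β * π ρ := by
      rw [hz'eq, map_add, map_mul, map_add, map_mul, map_mul, hπx, hπz, mul_zero, mul_zero, zero_add,
        add_zero]
    -- `π z'^p = - π f'' ∈ 𝔪̄^{d''} ⊆ 𝔪̄^{p+1}`
    have h1 : π z' ^ p ∈ maximalIdeal _ ^ (p + 1) := by
      have h0 : π (z' ^ p + f'') = 0 := by rw [← hu, map_mul, hπg, zero_mul]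
      rw [map_add, map_pow, add_eq_zero_iff_eq_neg] at h0
      rw [h0]
      exact Submodule.neg_mem _ (Ideal.pow_le_pow_right (by omega) (mk_mem_maximalIdeal_pow _ hf''))
    rw [hπz', mul_pow] at h1
    exact unit_mul_pow_not_mem_pow_succ hρ2 ((hβu.map π).pow p) p h1
  -- (5) the new parameter system `(z', x, ρ)` and Frobenius
  obtain ⟨lam', hlam'⟩ := hlam.exists_left_inv
  have hz₁ : z₁ = lam' * (z' - α * x - β * ρ) := by
    have : z' - α * x - β * ρ = lam * z₁ := by rw [hz'eq]; ring
    rw [this, ← mul_assoc, hlam', one_mul]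
  have hgen' : Ideal.span {z', x, ρ} = maximalIdeal L := by
    rw [← hgen]
    have hx1 : x ∈ Ideal.span ({z', x, ρ} : Set L) := Ideal.subset_span (by simp)
    have hρ1 : ρ ∈ Ideal.span ({z', x, ρ} : Set L) := Ideal.subset_span (by simp)
    have hz'1 : z' ∈ Ideal.span ({z', x, ρ} : Set L) := Ideal.subset_span (by simp)
    have hx2 : x ∈ Ideal.span ({x, ρ, z₁} : Set L) := Ideal.subset_span (by simp)
    have hρ2 : ρ ∈ Ideal.span ({x, ρ, z₁} : Set L) := Ideal.subset_span (by simp)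
    apply le_antisymm
    · rw [Ideal.span_le]
      rintro c (rfl | rfl | rfl)
      · exact hz'mem
      · exact hx2
      · exact hρ2
    · rw [Ideal.span_le]
      rintro c (rfl | rfl | rfl)
      · exact hx1
      · exact hρ1
      · rw [SetLike.mem_coe, hz₁]
        exact Ideal.mul_mem_left _ _ (Ideal.sub_mem _ (Ideal.sub_mem _ hz'1 (Ideal.mul_mem_left _ _ hx1))
          (Ideal.mul_mem_left _ _ hρ1))
  -- Frobenius: `lam^p z₁^p = z'^p - α^p x^p - β^p ρ^p`
  have hfrob : lam ^ p * z₁ ^ p = z' ^ p - α ^ p * x ^ p - β ^ p * ρ ^ p := by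
    have : lam * z₁ = z' - α * x - β * ρ := by rw [hz'eq]; ring
    rw [← mul_pow, this, sub_pow_char, sub_pow_char, mul_pow, mul_pow]
  -- the key identity: `lam^p x^m f - α^p x^p = g (lam^p - u) + f'' + β^p ρ^p`
  have hkey : lam ^ p * (x ^ m * f) - α ^ p * x ^ p = g * (lam ^ p - u) + f'' + β ^ p * ρ ^ p := by
    have hg' : z' ^ p = g * u - f'' := by rw [hu]; ring
    have : lam ^ p * g = lam ^ p * z₁ ^ p + lam ^ p * (x ^ m * f) := by rw [hg]; ring
    rw [hfrob, hg'] at this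
    linear_combination (-1 : L) * this
  -- suppose, for contradiction, `d'' ≥ m + μ + 1`
  by_contra hlt
  rw [not_le] at hlt
  set n := m + μ + 1 with hn
  have hnd : n ≤ d'' := by omega
  -- THE ONE CHANGE w.r.t. `core`: `n ≤ d'' < 2p` by the window bound, no tameness needed
  have hn2p : n ≤ 2 * p := by omega
  -- the right-hand side of `hkey` lies in `(z') + 𝔪^n`... read in `S = L/(z')`
  obtain ⟨hregS, hxS, hρS⟩ := quotient_single h3 hgen'
  haveI := hregS
  have hleS : Ideal.span {z'} ≤ maximalIdeal L := Ideal.span_le.mpr (Set.singleton_subset_iff.mpr hz')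
  haveI := nontrivial_quotient_of_le hleS
  set σ := Ideal.Quotient.mk (Ideal.span ({z'} : Set L)) with hσ
  have hσz' : σ z' = 0 := Ideal.Quotient.eq_zero_iff_mem.mpr (Ideal.subset_span (by simp))
  have hσg : σ g ∈ maximalIdeal _ ^ d'' := by
    -- `g = (z'^p + f'') u⁻¹`
    have : g = (z' ^ p + f'') * ↑u⁻¹ := by rw [← hu, mul_assoc, Units.mul_inv, mul_one]
    rw [this, map_mul, map_add, map_pow, hσz', zero_pow (by omega), zero_add]
    exact Ideal.mul_mem_right _ _ (mk_mem_maximalIdeal_pow _ hf'')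
  have hβρp : β ^ p * ρ ^ p ∈ maximalIdeal L ^ (2 * p) := by
    have hβρ : β * ρ ∈ maximalIdeal L ^ 2 := by rw [pow_two]; exact Ideal.mul_mem_mul hβ hρ𝔪
    have := Ideal.pow_mem_pow hβρ p
    rwa [← pow_mul, mul_pow] at this
  have hrhs : σ (g * (lam ^ p - u) + f'' + β ^ p * ρ ^ p) ∈ maximalIdeal _ ^ n := by
    have h1 : σ (g * (lam ^ p - u)) ∈ maximalIdeal _ ^ n := by
      rw [map_mul]; exact Ideal.mul_mem_right _ _ (Ideal.pow_le_pow_right hnd hσg)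
    have h2 : σ f'' ∈ maximalIdeal _ ^ n := Ideal.pow_le_pow_right hnd (mk_mem_maximalIdeal_pow _ hf'')
    have h3' : σ (β ^ p * ρ ^ p) ∈ maximalIdeal _ ^ n :=
      Ideal.pow_le_pow_right hn2p (mk_mem_maximalIdeal_pow _ hβρp)
    have := Ideal.add_mem _ (Ideal.add_mem _ h1 h2) h3'
    rwa [← map_add, ← map_add] at this
  -- hence `σ x ^ m * σ (lam^p f - α^p x^{p-m}) ∈ 𝔪̄^n`
  set H : L := lam ^ p * f - α ^ p * x ^ (p - m) with hH
  have hfac : lam ^ p * (x ^ m * f) - α ^ p * x ^ p = x ^ m * H := by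
    have : x ^ p = x ^ m * x ^ (p - m) := by rw [← pow_add, Nat.add_sub_cancel' hmp.le]
    rw [hH, this]; ring
  have hprod : σ x ^ m * σ H ∈ maximalIdeal _ ^ n := by
    have := hrhs
    rw [← hkey, hfac, map_mul, map_pow] at this
    exact this
  -- the order of `x̄` is exactly one, so `σ H ∈ 𝔪̄^{μ+1}`
  have hHS : σ H ∈ maximalIdeal _ ^ (μ + 1) := by
    by_contra hHS
    have h1 : σ x ^ m ∉ maximalIdeal _ ^ (m * 1 + 1) :=
      pow_not_mem_pow_of_not_mem_pow (p := 1) (by simpa using hxS) m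
    rw [mul_one] at h1
    have := mul_not_mem_pow_of_not_mem_pow h1 hHS
    rw [show m + μ + 1 = n from rfl] at this
    exact this hprod
  -- pull back to `L`: `H ∈ (z') + 𝔪^{μ+1}`
  have hHL : H ∈ Ideal.span {z'} ⊔ maximalIdeal L ^ (μ + 1) := mem_sup_pow_of_mk_mem _ hHS
  -- (5b) read `H` in `T = L/(z', x)`: there `H ↦ lam^p ρ^μ G`, a unit times `ρ̄^μ`
  obtain ⟨hregT, hρT⟩ := quotient_pair h3 hgen'
  haveI := hregT
  have hleT : Ideal.span {z', x} ≤ maximalIdeal L := by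
    rw [Ideal.span_le]; intro a ha; rcases ha with rfl | rfl <;> simpa
  haveI := nontrivial_quotient_of_le hleT
  set τ := Ideal.Quotient.mk (Ideal.span ({z', x} : Set L)) with hτ
  have hτz' : τ z' = 0 := Ideal.Quotient.eq_zero_iff_mem.mpr (Ideal.subset_span (by simp))
  have hτx : τ x = 0 := Ideal.Quotient.eq_zero_iff_mem.mpr (Ideal.subset_span (by simp))
  have hτf : τ f = τ ρ ^ μ * τ G := by
    obtain ⟨c, hc⟩ := Ideal.mem_span_singleton'.mp hf
    have : f = ρ ^ μ * G + c * x := by rw [hc]; ring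
    rw [this, map_add, map_mul, map_mul, map_pow, hτx, mul_zero, add_zero]
  have hpm : p - m ≠ 0 := by omega
  have hτH : τ H = τ (lam ^ p * G) * τ ρ ^ μ := by
    rw [hH]
    simp only [map_sub, map_mul, map_pow, hτx, zero_pow hpm, mul_zero, sub_zero, hτf]
    ring
  have hτHmem : τ H ∈ maximalIdeal _ ^ (μ + 1) := by
    obtain ⟨s, hs, q, hq, hsq⟩ := Submodule.mem_sup.mp hHL
    rw [← hsq, map_add]
    refine Ideal.add_mem _ ?_ (mk_mem_maximalIdeal_pow _ hq)
    obtain ⟨c, rfl⟩ := Ideal.mem_span_singleton'.mp hs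
    rw [map_mul, hτz', mul_zero]
    exact Ideal.zero_mem _
  rw [hτH] at hτHmem
  have hunit : IsUnit (τ (lam ^ p * G)) := ((hlam.pow p).mul hG).map τ
  exact unit_mul_pow_not_mem_pow_succ hρT hunit μ hτHmem

/-- **The window-exponent form of `core_le`** (the shape the step files consume, `m = d − p`): with `p < d < 2p` downstairs and a
window presentation `p < d″ < 2p` upstairs, `d″ + p ≤ d + μ`; in particular `d″ ≤ d` when `μ ≤ p` and `d″ < d` when `μ < p`.
NOT a statement of the manuscript. [folklore] -/
theorem core_le_window (p : ℕ) [Fact p.Prime] [CharP L p] (h3 : (maximalIdeal L).spanFinrank = 3)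
    {x ρ z₁ : L} (hgen : Ideal.span {x, ρ, z₁} = maximalIdeal L)
    {d μ : ℕ} (hpd : p < d) (hd2 : d < 2 * p)
    {f G : L} (hG : IsUnit G) (hf : f - ρ ^ μ * G ∈ Ideal.span {x})
    {z' f'' : L} {d'' : ℕ} (hz' : z' ∈ maximalIdeal L) (hf'' : f'' ∈ maximalIdeal L ^ d'')
    (hpd'' : p < d'') (hd2'' : d'' < 2 * p)
    (heq : Ideal.span {z₁ ^ p + x ^ (d - p) * f} = Ideal.span {z' ^ p + f''}) :
    d'' + p ≤ d + μ := by
  have h := core_le p h3 hgen (m := d - p) (by omega) (by omega) hG hf hz' hf'' hpd'' hd2'' heq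
  omega

end Summit.ResolutionOfSingularities.ResolutionOfSingularities.Theorems.CampaignW46.MohWindowSurface

end
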